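import Literature.RingTheory.JacobsonRadical.VonNeumannRegularSummands
import Mathlib.Algebra.Module.Projective
import Mathlib.LinearAlgebra.Matrix.ToLin
import Mathlib.RingTheory.Finiteness.Basic
import HarnessLib

/-!
# Lam §6 Exercise 6.20: matrix rings (endomorphism rings of free modules of finite rank) over a von Neumann regular ring are
# von Neumann regular

[cite: Lam2001FirstCourse, §6 Exercise 6.20, p. 99]

Lam, *A First Course in Noncommutative Rings*, Exercises for §6 (p. 99; p0111 of the held scan):

**Ex. 6.20.** Show that the conclusion of the last exercise [Ex. 6.19: over a von Neumann regular ring `k`, finitely generated submodules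
of projective modules are direct summands] is equivalent to the fact that, if `k` is a von Neumann regular ring, then so is `M_n(k)` for
any `n ≥ 1`.

With Exercise 6.19 in the tree (`VonNeumannRegularSummands.exists_isCompl_of_fg_of_basis`) this file proves the forward implication and
hence the fact itself: for `k` von Neumann regular, `End_k(V)` is von Neumann regular for every `k`-module `V` with a finite basis
(`forall_exists_mul_mul_self_moduleEnd_of_basis`), and so is the matrix ring `M_n(k)` (`forall_exists_mul_mul_self_matrix`, through
`Matrix.toLinearMapRight'`, matrices acting on row vectors from the right). The mechanism, as in the tree's proof of (4.27): if the
image `f(V)` of an endomorphism `f` of a projective module is a direct summand, then `f(V)` is projective, `f : V ↠ f(V)` has a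
section `h`, and `g = h ∘ pr_{f(V)}` satisfies `fgf = f` (`exists_mul_mul_self_eq_of_isCompl_range`). «von Neumann regular» is spelled
`∀ a, ∃ x, a * x * a = a` as in `VonNeumannRegularRings`.
-- TODO(general form): the reverse implication of Ex. 6.20 (all `M_n(k)` regular ⟹ the conclusion of Ex. 6.19).

## References

* [Lam2001FirstCourse] T. Y. Lam, *A First Course in Noncommutative Rings*, 2nd ed., Graduate Texts in Mathematics 131, Springer, 2001,
  §6 Exercises 6.19–6.20, p. 99 (held scan `book:lamnd-first-course-noncommutative-rings`, p0111); §4 Prop. (4.27) (proof).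
-/

universe u v

namespace Literature.RingTheory.JacobsonRadical

variable {k : Type u} [Ring k]

/-! ## §1 An endomorphism of a projective module with complemented image is regular -/

/-- If `V` is projective and the image of `f ∈ End_k(V)` is a direct summand of `V`, then `fgf = f` for some `g` — namely
`g = h ∘ pr_{f(V)}` with `h` a section of `f : V ↠ f(V)` (`f(V)` is projective). [cite: Lam2001FirstCourse, §4 Prop. (4.27) (proof); §6
Exercise 6.20] -/
theorem exists_mul_mul_self_eq_of_isCompl_range {V : Type v} [AddCommGroup V] [Module k V] [Module.Projective k V] (f : Module.End k V)
    {P : Submodule k V} (hP : IsCompl (LinearMap.range f) P) : ∃ g : Module.End k V, f * g * f = f := by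
  -- `f(V)` is a direct summand of the projective module `V`, hence projective
  haveI : Module.Projective k (LinearMap.range f) :=
    Module.Projective.of_split (LinearMap.range f).subtype (Submodule.projectionOnto (LinearMap.range f) P hP)
      (LinearMap.ext fun x ↦ Submodule.projectionOnto_apply_left hP x)
  -- a section `h` of `f : V ↠ f(V)`
  obtain ⟨h, hh⟩ := Module.projective_lifting_property f.rangeRestrict (LinearMap.id : LinearMap.range f →ₗ[k] LinearMap.range f)
    f.surjective_rangeRestrict
  refine ⟨h ∘ₗ Submodule.projectionOnto (LinearMap.range f) P hP, LinearMap.ext fun v ↦ ?_⟩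
  have h1 : Submodule.projectionOnto (LinearMap.range f) P hP (f v) = ⟨f v, LinearMap.mem_range_self f v⟩ :=
    Submodule.projectionOnto_apply_left hP ⟨f v, LinearMap.mem_range_self f v⟩
  have h2 : f (h ⟨f v, LinearMap.mem_range_self f v⟩) = f v := by
    have h3 := congrArg Subtype.val (LinearMap.congr_fun hh ⟨f v, LinearMap.mem_range_self f v⟩)
    rwa [LinearMap.comp_apply, LinearMap.id_apply, LinearMap.codRestrict_apply] at h3
  rw [Module.End.mul_apply, Module.End.mul_apply, LinearMap.comp_apply, h1, h2]

/-! ## §2 Exercise 6.20: `End_k(V)` and `M_n(k)` -/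

/-- **LAM Exercise 6.20 (with 6.19): over a von Neumann regular ring `k`, the endomorphism ring of every `k`-module with a finite basis
is von Neumann regular** — the image of an endomorphism is finitely generated, hence a direct summand by Exercise 6.19.
[cite: Lam2001FirstCourse, §6 Exercise 6.20] -/
theorem forall_exists_mul_mul_self_moduleEnd_of_basis (hR : ∀ a : k, ∃ x, a * x * a = a) {V : Type v} [AddCommGroup V] [Module k V]
    {ι : Type*} [Finite ι] (b : Module.Basis ι k V) : ∀ f : Module.End k V, ∃ g : Module.End k V, f * g * f = f := fun f ↦ by
  haveI : Module.Projective k V := Module.Projective.of_basis b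
  haveI : Module.Finite k V := Module.Finite.of_basis b
  have hfg : (LinearMap.range f).FG := by
    rw [LinearMap.range_eq_map]
    exact Module.Finite.fg_top.map f
  obtain ⟨P, hP⟩ := exists_isCompl_of_fg_of_basis hR b (LinearMap.range f) hfg
  exact exists_mul_mul_self_eq_of_isCompl_range f hP

/-- **LAM Exercise 6.20: if `k` is von Neumann regular, then so is `M_n(k)` for every `n`** (matrices act on row vectors `kⁿ` from the
right, `Matrix.toLinearMapRight'`, an anti-isomorphism onto `End_k(kⁿ)`). [cite: Lam2001FirstCourse, §6 Exercise 6.20] -/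
theorem forall_exists_mul_mul_self_matrix (hR : ∀ a : k, ∃ x, a * x * a = a) {n : Type*} [Fintype n] [DecidableEq n] :
    ∀ A : Matrix n n k, ∃ B : Matrix n n k, A * B * A = A := fun A ↦ by
  obtain ⟨g, hg⟩ := forall_exists_mul_mul_self_moduleEnd_of_basis hR (Pi.basisFun k n) (Matrix.toLinearMapRight' A)
  refine ⟨Matrix.toLinearMapRight'.symm g, Matrix.toLinearMapRight'.injective ?_⟩
  rw [Matrix.toLinearMapRight'_mul, Matrix.toLinearMapRight'_mul, LinearEquiv.apply_symm_apply]
  rw [Module.End.mul_eq_comp, Module.End.mul_eq_comp] at hg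
  rw [← LinearMap.comp_assoc, hg]

end Literature.RingTheory.JacobsonRadical
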